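import Summits.RiemannHypothesis.RiemannHypothesis.Theorems.WeilFormatCDataO1035FrontDataW
import Summits.RiemannHypothesis.RiemannHypothesis.Theorems.WeilFormatCDataA1RungCB
import Summits.RiemannHypothesis.RiemannHypothesis.Theorems.S2FormatCE0
import Literature.NumberTheory.LFunctions.YoshidaWindowGramTailMSSines
import Literature.NumberTheory.LFunctions.YoshidaWindowGramMiddleJBox
import Literature.NumberTheory.LFunctions.YoshidaWindowGramTailJFactoredScaled
import Literature.NumberTheory.LFunctions.YoshidaWindowGramTailMSFactored
import Literature.NumberTheory.LFunctions.YoshidaWindowGramTailJDiagTight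
import Summits.RiemannHypothesis.RiemannHypothesis.Theorems.FormatCPsdBands
import Summits.RiemannHypothesis.RiemannHypothesis.Theorems.WeilFormatCDiagShift
import Summits.RiemannHypothesis.RiemannHypothesis.Theorems.FormatCPsdSymmBands
import HarnessLib
import Summits.RiemannHypothesis.RiemannHypothesis.Theorems.WeilFormatCDataO1035Tables1
import Summits.RiemannHypothesis.RiemannHypothesis.Theorems.WeilFormatCDataO1035Tables2
import Summits.RiemannHypothesis.RiemannHypothesis.Theorems.WeilFormatCDataO1035Tables3
import Summits.RiemannHypothesis.RiemannHypothesis.Theorems.WeilFormatCDataO1035Tables4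
import Summits.RiemannHypothesis.RiemannHypothesis.Theorems.WeilFormatCDataO1035Tables
import Summits.RiemannHypothesis.RiemannHypothesis.Theorems.WeilFormatCDataO1035ColTables1
import Summits.RiemannHypothesis.RiemannHypothesis.Theorems.WeilFormatCDataO1035ColTables2
import Summits.RiemannHypothesis.RiemannHypothesis.Theorems.WeilFormatCDataO1035ColTables3
import Summits.RiemannHypothesis.RiemannHypothesis.Theorems.WeilFormatCDataO1035ColTables4
import Summits.RiemannHypothesis.RiemannHypothesis.Theorems.WeilFormatCDataO1035ColTables5
import Summits.RiemannHypothesis.RiemannHypothesis.Theorems.WeilFormatCDataO1035ColTables6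
import Summits.RiemannHypothesis.RiemannHypothesis.Theorems.WeilFormatCDataO1035ColTables7
import Summits.RiemannHypothesis.RiemannHypothesis.Theorems.WeilFormatCDataO1035ColTables8
import Summits.RiemannHypothesis.RiemannHypothesis.Theorems.WeilFormatCDataO1035ColTables9
import Summits.RiemannHypothesis.RiemannHypothesis.Theorems.WeilFormatCDataO1035ColTables10
import Summits.RiemannHypothesis.RiemannHypothesis.Theorems.WeilFormatCDataO1035ColTables11
import Summits.RiemannHypothesis.RiemannHypothesis.Theorems.WeilFormatCDataO1035ColTables12
import Summits.RiemannHypothesis.RiemannHypothesis.Theorems.WeilFormatCDataO1035ColTables13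
import Summits.RiemannHypothesis.RiemannHypothesis.Theorems.WeilFormatCDataO1035ColTables14
import Summits.RiemannHypothesis.RiemannHypothesis.Theorems.WeilFormatCDataO1035ColTables15
import Summits.RiemannHypothesis.RiemannHypothesis.Theorems.WeilFormatCDataO1035ColTables16
import Summits.RiemannHypothesis.RiemannHypothesis.Theorems.WeilFormatCDataO1035ColTables17
import Summits.RiemannHypothesis.RiemannHypothesis.Theorems.WeilFormatCDataO1035ColTables18
import Summits.RiemannHypothesis.RiemannHypothesis.Theorems.WeilFormatCDataO1035ColTables19
import Summits.RiemannHypothesis.RiemannHypothesis.Theorems.WeilFormatCDataO1035ColTables20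
import Summits.RiemannHypothesis.RiemannHypothesis.Theorems.WeilFormatCDataO1035ColTables21
import Summits.RiemannHypothesis.RiemannHypothesis.Theorems.WeilFormatCDataO1035ColTables22
import Summits.RiemannHypothesis.RiemannHypothesis.Theorems.WeilFormatCDataO1035ColTables23
import Summits.RiemannHypothesis.RiemannHypothesis.Theorems.WeilFormatCDataO1035ColTables24
import Summits.RiemannHypothesis.RiemannHypothesis.Theorems.WeilFormatCDataO1035ColTables25
import Summits.RiemannHypothesis.RiemannHypothesis.Theorems.WeilFormatCDataO1035ColTables26
import Summits.RiemannHypothesis.RiemannHypothesis.Theorems.WeilFormatCDataO1035ColTables27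
import Summits.RiemannHypothesis.RiemannHypothesis.Theorems.WeilFormatCDataO1035ColTables28
import Summits.RiemannHypothesis.RiemannHypothesis.Theorems.WeilFormatCDataO1035ColTables29
import Summits.RiemannHypothesis.RiemannHypothesis.Theorems.WeilFormatCDataO1035ColTables30
import Summits.RiemannHypothesis.RiemannHypothesis.Theorems.WeilFormatCDataO1035ColTables31
import Summits.RiemannHypothesis.RiemannHypothesis.Theorems.WeilFormatCDataO1035ColTables32
import Summits.RiemannHypothesis.RiemannHypothesis.Theorems.WeilFormatCDataO1035ColTables33
import Summits.RiemannHypothesis.RiemannHypothesis.Theorems.WeilFormatCDataO1035ColTables34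
import Summits.RiemannHypothesis.RiemannHypothesis.Theorems.WeilFormatCDataO1035ColTables35
import Summits.RiemannHypothesis.RiemannHypothesis.Theorems.WeilFormatCDataO1035ColTables
import Summits.RiemannHypothesis.RiemannHypothesis.Theorems.WeilFormatCDataO1035CBOddXP1
import Summits.RiemannHypothesis.RiemannHypothesis.Theorems.WeilFormatCDataO1035CBOddXP2
import Summits.RiemannHypothesis.RiemannHypothesis.Theorems.WeilFormatCDataO1035CBOddXP3
import Summits.RiemannHypothesis.RiemannHypothesis.Theorems.WeilFormatCDataO1035CBOddXP4
import Summits.RiemannHypothesis.RiemannHypothesis.Theorems.WeilFormatCDataO1035CBOddXP5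
import Summits.RiemannHypothesis.RiemannHypothesis.Theorems.WeilFormatCDataO1035CBOddXP6
import Summits.RiemannHypothesis.RiemannHypothesis.Theorems.WeilFormatCDataO1035CBOddXP7
import Summits.RiemannHypothesis.RiemannHypothesis.Theorems.WeilFormatCDataO1035CBOddXP8
import Summits.RiemannHypothesis.RiemannHypothesis.Theorems.WeilFormatCDataO1035CBOddXP9
import Summits.RiemannHypothesis.RiemannHypothesis.Theorems.WeilFormatCDataO1035CBOddXP10
import Summits.RiemannHypothesis.RiemannHypothesis.Theorems.WeilFormatCDataO1035CBOddXP11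
import Summits.RiemannHypothesis.RiemannHypothesis.Theorems.WeilFormatCDataO1035CBOddXP12
import Summits.RiemannHypothesis.RiemannHypothesis.Theorems.WeilFormatCDataO1035CBOddXP13
import Summits.RiemannHypothesis.RiemannHypothesis.Theorems.WeilFormatCDataO1035CBOddXP14
import Summits.RiemannHypothesis.RiemannHypothesis.Theorems.WeilFormatCDataO1035CBOddXP15
import Summits.RiemannHypothesis.RiemannHypothesis.Theorems.WeilFormatCDataO1035CBOddXP16
import Summits.RiemannHypothesis.RiemannHypothesis.Theorems.WeilFormatCDataO1035CBOddDSP1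
import Summits.RiemannHypothesis.RiemannHypothesis.Theorems.WeilFormatCDataO1035CBOddDSP2
import Summits.RiemannHypothesis.RiemannHypothesis.Theorems.WeilFormatCDataO1035CBOddDSP3
import Summits.RiemannHypothesis.RiemannHypothesis.Theorems.WeilFormatCDataO1035CBOddDSP4
import Summits.RiemannHypothesis.RiemannHypothesis.Theorems.WeilFormatCDataO1035CBOddDSP5
import Summits.RiemannHypothesis.RiemannHypothesis.Theorems.WeilFormatCDataO1035CBOddDSP6
import Summits.RiemannHypothesis.RiemannHypothesis.Theorems.WeilFormatCDataO1035CBOddDSP7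
import Summits.RiemannHypothesis.RiemannHypothesis.Theorems.WeilFormatCDataO1035CBOddDSP8
import Summits.RiemannHypothesis.RiemannHypothesis.Theorems.WeilFormatCDataO1035CBOddDSP9
import Summits.RiemannHypothesis.RiemannHypothesis.Theorems.WeilFormatCDataO1035CBOddDSP10
import Summits.RiemannHypothesis.RiemannHypothesis.Theorems.WeilFormatCDataO1035CBOddDSP11
import Summits.RiemannHypothesis.RiemannHypothesis.Theorems.WeilFormatCDataO1035CBOddDSP12
import Summits.RiemannHypothesis.RiemannHypothesis.Theorems.WeilFormatCDataO1035CBOddDSP13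
import Summits.RiemannHypothesis.RiemannHypothesis.Theorems.WeilFormatCDataO1035CBOddDSP14
import Summits.RiemannHypothesis.RiemannHypothesis.Theorems.WeilFormatCDataO1035CBOddDSP15
import Summits.RiemannHypothesis.RiemannHypothesis.Theorems.WeilFormatCDataO1035CBOddDSP16
import Summits.RiemannHypothesis.RiemannHypothesis.Theorems.WeilFormatCDataO1035CBOddDSP17
import Summits.RiemannHypothesis.RiemannHypothesis.Theorems.WeilFormatCDataO1035CBOddDSP18
import Summits.RiemannHypothesis.RiemannHypothesis.Theorems.WeilFormatCDataO1035CBOddDSP19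
import Summits.RiemannHypothesis.RiemannHypothesis.Theorems.WeilFormatCDataO1035CBOddLP1
import Summits.RiemannHypothesis.RiemannHypothesis.Theorems.WeilFormatCDataO1035CBOddLP2
import Summits.RiemannHypothesis.RiemannHypothesis.Theorems.WeilFormatCDataO1035CBOddLP3
import Summits.RiemannHypothesis.RiemannHypothesis.Theorems.WeilFormatCDataO1035CBOddLP4
import Summits.RiemannHypothesis.RiemannHypothesis.Theorems.WeilFormatCDataO1035CBOddLP5
import Summits.RiemannHypothesis.RiemannHypothesis.Theorems.WeilFormatCDataO1035CBOddLP6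
import Summits.RiemannHypothesis.RiemannHypothesis.Theorems.WeilFormatCDataO1035CBOddLP7
import Summits.RiemannHypothesis.RiemannHypothesis.Theorems.WeilFormatCDataO1035CBOddLP8
import Summits.RiemannHypothesis.RiemannHypothesis.Theorems.WeilFormatCDataO1035CBOddTF
import Summits.RiemannHypothesis.RiemannHypothesis.Theorems.WeilFormatCDataO1035CBOddRD
import Summits.RiemannHypothesis.RiemannHypothesis.Theorems.WeilFormatCDataO1035FrontData
import Summits.RiemannHypothesis.RiemannHypothesis.Theorems.WeilFormatCDataO1035CBOddPsd0
import Summits.RiemannHypothesis.RiemannHypothesis.Theorems.WeilFormatCDataO1035CBOddPsd1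
import Summits.RiemannHypothesis.RiemannHypothesis.Theorems.WeilFormatCDataO1035CBOddPsd2
import Summits.RiemannHypothesis.RiemannHypothesis.Theorems.WeilFormatCDataO1035CBOddPsd3
import Summits.RiemannHypothesis.RiemannHypothesis.Theorems.WeilFormatCDataO1035CBOddPsd4
import Summits.RiemannHypothesis.RiemannHypothesis.Theorems.WeilFormatCDataO1035CBOddPsd5
import Summits.RiemannHypothesis.RiemannHypothesis.Theorems.WeilFormatCDataO1035CBOddPsd6
import Summits.RiemannHypothesis.RiemannHypothesis.Theorems.WeilFormatCDataO1035CBOddPsd7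
import Summits.RiemannHypothesis.RiemannHypothesis.Theorems.WeilFormatCDataO1035CBOddPsd8
import Summits.RiemannHypothesis.RiemannHypothesis.Theorems.WeilFormatCDataO1035CBOddPsd9
import Summits.RiemannHypothesis.RiemannHypothesis.Theorems.WeilFormatCDataO1035CBOddPsd10
import Summits.RiemannHypothesis.RiemannHypothesis.Theorems.WeilFormatCDataO1035CBOddPsd11
import Summits.RiemannHypothesis.RiemannHypothesis.Theorems.WeilFormatCDataO1035CBOddPsd12
import Summits.RiemannHypothesis.RiemannHypothesis.Theorems.WeilFormatCDataO1035CBOddPsd13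
import Summits.RiemannHypothesis.RiemannHypothesis.Theorems.WeilFormatCDataO1035CBOddPsd14
import Summits.RiemannHypothesis.RiemannHypothesis.Theorems.WeilFormatCDataO1035CBOddPsd15

/-!
# Format C kernel rung `O1035` (a = 207/200, column-band layout): ASSEMBLY of the flat layout, part O of 15 (ladders of CBOddPsd15; split of the 2979-line assembly at block boundaries by prover B g19 for the 400-line cap; blocks byte-identical): every propositional ladder of the kernel files (table/column validity, front door, sines, middle moments, column data, tail factors, Schur rows, (P) + diagonal shift), byte-identical statements and proofs, original order (A g22 restage_flat.py; weil-2 KERNEL-CHAIN-RULES #1)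

Window `a = 207/200`; prime powers in the window: 2, 3, 2^2, 5, 7; prime constant A = 2148/1000 (`WeilFormatC.primeCoeff_form_ge_cells_v2`); evaluator parameters S = 2^320, Kpi 160, Kser 190, kred 8, Kexp 55, J 150; full table modes < 257; light column table modes < 2051; units 2^-310 (Schur entries), 2^-154 (column digits, width 157), 2^-148 (tail-factor digits, width 151), 2^-64 (reciprocal weights), 2^-40 (tail base); order-J tail J = 4, θ = 1/2048, η = 1/10 | 4/1.
Design row: sr-gb-rung-b B g21 hp odd λ-run (parity cell 14 L-side): a = 207/200, A = 2148/1000 (cells_v2), μ = 2^-97, odd 256/512/2048, kit precision S 2^320 / c 310 / Kpi 160 / Kser 190 / Kexp 55 / J 150 (A g23 hp levers), MS tail; see HOME(B)/CELL14-LSIDE-B-g21.md. Generated by sr-gb-rung-a prover A g22 with rh-explicit-weil-2 gen7's generator extended for the odd λ-run (--sector odd --mu-log2; HOME(A)/code-g22/gen7/gramgen7.py sha16 b21c14hp10350001) from `#eval` of the tree's `Encl` functions; every datum is re-verified by the kernel in the theorem files (`decide +kernel`). Helper data of the rh-explicit Weil-positivity programme (format C, K-CELL-2), RH-free. [cite: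 Yoshida1992HermitianForms, §5 (5.15)-(5.16) p. 301; §7 pp. 305–312]
-/

set_option linter.dupNamespace false
set_option exponentiation.threshold 1024
set_option maxRecDepth 200000

-- ===== from WeilFormatCDataO1035CBOddPsd15 =====
namespace Summit.RiemannHypothesis.RiemannHypothesis.Theorems.WeilFormatCData.O1035CBOdd
open Literature.NumberTheory.LFunctions Literature.NumberTheory.LFunctions.PsdDyadic Summit.RiemannHypothesis.RiemannHypothesis.Theorems.FormatCPsd

/-- (P) shapes and symmetry of `DS'`, assembled from the length fact and the symmetry row bands (`checkPsdShape_of_symmBands`). -/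
theorem tShape : checkPsdShape 256 O1035CBOdd.DS' O1035CBOdd.L = true := by
  refine checkPsdShape_of_symmBands tLens fun i hi ↦ ?_
  by_cases hy0 : i < 8
  · exact ⟨0, 8, tSy0, by omega, by omega⟩
  by_cases hy8 : i < 16
  · exact ⟨8, 8, tSy8, by omega, by omega⟩
  by_cases hy16 : i < 24
  · exact ⟨16, 8, tSy16, by omega, by omega⟩
  by_cases hy24 : i < 32
  · exact ⟨24, 8, tSy24, by omega, by omega⟩
  by_cases hy32 : i < 40
  · exact ⟨32, 8, tSy32, by omega, by omega⟩
  by_cases hy40 : i < 48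
  · exact ⟨40, 8, tSy40, by omega, by omega⟩
  by_cases hy48 : i < 56
  · exact ⟨48, 8, tSy48, by omega, by omega⟩
  by_cases hy56 : i < 64
  · exact ⟨56, 8, tSy56, by omega, by omega⟩
  by_cases hy64 : i < 72
  · exact ⟨64, 8, tSy64, by omega, by omega⟩
  by_cases hy72 : i < 80
  · exact ⟨72, 8, tSy72, by omega, by omega⟩
  by_cases hy80 : i < 88
  · exact ⟨80, 8, tSy80, by omega, by omega⟩
  by_cases hy88 : i < 96
  · exact ⟨88, 8, tSy88, by omega, by omega⟩
  by_cases hy96 : i < 104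
  · exact ⟨96, 8, tSy96, by omega, by omega⟩
  by_cases hy104 : i < 112
  · exact ⟨104, 8, tSy104, by omega, by omega⟩
  by_cases hy112 : i < 120
  · exact ⟨112, 8, tSy112, by omega, by omega⟩
  by_cases hy120 : i < 128
  · exact ⟨120, 8, tSy120, by omega, by omega⟩
  by_cases hy128 : i < 136
  · exact ⟨128, 8, tSy128, by omega, by omega⟩
  by_cases hy136 : i < 144
  · exact ⟨136, 8, tSy136, by omega, by omega⟩
  by_cases hy144 : i < 152
  · exact ⟨144, 8, tSy144, by omega, by omega⟩
  by_cases hy152 : i < 160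
  · exact ⟨152, 8, tSy152, by omega, by omega⟩
  by_cases hy160 : i < 168
  · exact ⟨160, 8, tSy160, by omega, by omega⟩
  by_cases hy168 : i < 176
  · exact ⟨168, 8, tSy168, by omega, by omega⟩
  by_cases hy176 : i < 184
  · exact ⟨176, 8, tSy176, by omega, by omega⟩
  by_cases hy184 : i < 192
  · exact ⟨184, 8, tSy184, by omega, by omega⟩
  by_cases hy192 : i < 200
  · exact ⟨192, 8, tSy192, by omega, by omega⟩
  by_cases hy200 : i < 208
  · exact ⟨200, 8, tSy200, by omega, by omega⟩
  by_cases hy208 : i < 216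
  · exact ⟨208, 8, tSy208, by omega, by omega⟩
  by_cases hy216 : i < 224
  · exact ⟨216, 8, tSy216, by omega, by omega⟩
  by_cases hy224 : i < 232
  · exact ⟨224, 8, tSy224, by omega, by omega⟩
  by_cases hy232 : i < 240
  · exact ⟨232, 8, tSy232, by omega, by omega⟩
  by_cases hy240 : i < 248
  · exact ⟨240, 8, tSy240, by omega, by omega⟩
  exact ⟨248, 8, tSy248, by omega, by omega⟩

/-- **(P)**: `checkPsdMid 256 δ rho DS' L` (assembled from the row bands). -/
theorem checkPsdMid_holds : checkPsdMid 256 O1035CBOdd.δ O1035CBOdd.rho O1035CBOdd.DS' O1035CBOdd.L = true := by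
  refine checkPsdMid_of_bands tShape fun t ht ↦ ?_
  have hlen : t < DS'.length := by rw [tLen]; exact ht
  by_cases hb0 : t < 8
  · exact rowBudget_of_checkPsdBand tPB0 (by omega) (by omega) hlen
  by_cases hb8 : t < 16
  · exact rowBudget_of_checkPsdBand tPB8 (by omega) (by omega) hlen
  by_cases hb16 : t < 24
  · exact rowBudget_of_checkPsdBand tPB16 (by omega) (by omega) hlen
  by_cases hb24 : t < 32
  · exact rowBudget_of_checkPsdBand tPB24 (by omega) (by omega) hlen
  by_cases hb32 : t < 40
  · exact rowBudget_of_checkPsdBand tPB32 (by omega) (by omega) hlen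
  by_cases hb40 : t < 48
  · exact rowBudget_of_checkPsdBand tPB40 (by omega) (by omega) hlen
  by_cases hb48 : t < 56
  · exact rowBudget_of_checkPsdBand tPB48 (by omega) (by omega) hlen
  by_cases hb56 : t < 64
  · exact rowBudget_of_checkPsdBand tPB56 (by omega) (by omega) hlen
  by_cases hb64 : t < 72
  · exact rowBudget_of_checkPsdBand tPB64 (by omega) (by omega) hlen
  by_cases hb72 : t < 80
  · exact rowBudget_of_checkPsdBand tPB72 (by omega) (by omega) hlen
  by_cases hb80 : t < 88
  · exact rowBudget_of_checkPsdBand tPB80 (by omega) (by omega) hlen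
  by_cases hb88 : t < 96
  · exact rowBudget_of_checkPsdBand tPB88 (by omega) (by omega) hlen
  by_cases hb96 : t < 104
  · exact rowBudget_of_checkPsdBand tPB96 (by omega) (by omega) hlen
  by_cases hb104 : t < 112
  · exact rowBudget_of_checkPsdBand tPB104 (by omega) (by omega) hlen
  by_cases hb112 : t < 120
  · exact rowBudget_of_checkPsdBand tPB112 (by omega) (by omega) hlen
  by_cases hb120 : t < 128
  · exact rowBudget_of_checkPsdBand tPB120 (by omega) (by omega) hlen
  by_cases hb128 : t < 136
  · exact rowBudget_of_checkPsdBand tPB128 (by omega) (by omega) hlen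
  by_cases hb136 : t < 144
  · exact rowBudget_of_checkPsdBand tPB136 (by omega) (by omega) hlen
  by_cases hb144 : t < 152
  · exact rowBudget_of_checkPsdBand tPB144 (by omega) (by omega) hlen
  by_cases hb152 : t < 160
  · exact rowBudget_of_checkPsdBand tPB152 (by omega) (by omega) hlen
  by_cases hb160 : t < 168
  · exact rowBudget_of_checkPsdBand tPB160 (by omega) (by omega) hlen
  by_cases hb168 : t < 176
  · exact rowBudget_of_checkPsdBand tPB168 (by omega) (by omega) hlen
  by_cases hb176 : t < 184
  · exact rowBudget_of_checkPsdBand tPB176 (by omega) (by omega) hlen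
  by_cases hb184 : t < 192
  · exact rowBudget_of_checkPsdBand tPB184 (by omega) (by omega) hlen
  by_cases hb192 : t < 200
  · exact rowBudget_of_checkPsdBand tPB192 (by omega) (by omega) hlen
  by_cases hb200 : t < 208
  · exact rowBudget_of_checkPsdBand tPB200 (by omega) (by omega) hlen
  by_cases hb208 : t < 216
  · exact rowBudget_of_checkPsdBand tPB208 (by omega) (by omega) hlen
  by_cases hb216 : t < 224
  · exact rowBudget_of_checkPsdBand tPB216 (by omega) (by omega) hlen
  by_cases hb224 : t < 232
  · exact rowBudget_of_checkPsdBand tPB224 (by omega) (by omega) hlen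
  by_cases hb232 : t < 240
  · exact rowBudget_of_checkPsdBand tPB232 (by omega) (by omega) hlen
  by_cases hb240 : t < 248
  · exact rowBudget_of_checkPsdBand tPB240 (by omega) (by omega) hlen
  exact rowBudget_of_checkPsdBand tPB248 (by omega) (by omega) hlen

/-- **λ-run**: `DS' = DS − lamZ·1` on the whole `256 × 256` block (assembled from the row bands). -/
theorem hDS : ∀ k < 256, ∀ k' < 256, PsdDyadic.getMZ O1035CBOdd.DS' k k' = PsdDyadic.getMZ O1035CBOdd.DS k k' - (if k = k' then O1035CBOdd.lamZ else 0) := by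
  intro k hk
  by_cases hs0 : k < 8
  · exact WeilFormatC.diagShift_row_of_check tSh0 k (by omega) (by omega)
  by_cases hs8 : k < 16
  · exact WeilFormatC.diagShift_row_of_check tSh8 k (by omega) (by omega)
  by_cases hs16 : k < 24
  · exact WeilFormatC.diagShift_row_of_check tSh16 k (by omega) (by omega)
  by_cases hs24 : k < 32
  · exact WeilFormatC.diagShift_row_of_check tSh24 k (by omega) (by omega)
  by_cases hs32 : k < 40
  · exact WeilFormatC.diagShift_row_of_check tSh32 k (by omega) (by omega)
  by_cases hs40 : k < 48
  · exact WeilFormatC.diagShift_row_of_check tSh40 k (by omega) (by omega)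
  by_cases hs48 : k < 56
  · exact WeilFormatC.diagShift_row_of_check tSh48 k (by omega) (by omega)
  by_cases hs56 : k < 64
  · exact WeilFormatC.diagShift_row_of_check tSh56 k (by omega) (by omega)
  by_cases hs64 : k < 72
  · exact WeilFormatC.diagShift_row_of_check tSh64 k (by omega) (by omega)
  by_cases hs72 : k < 80
  · exact WeilFormatC.diagShift_row_of_check tSh72 k (by omega) (by omega)
  by_cases hs80 : k < 88
  · exact WeilFormatC.diagShift_row_of_check tSh80 k (by omega) (by omega)
  by_cases hs88 : k < 96
  · exact WeilFormatC.diagShift_row_of_check tSh88 k (by omega) (by omega)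
  by_cases hs96 : k < 104
  · exact WeilFormatC.diagShift_row_of_check tSh96 k (by omega) (by omega)
  by_cases hs104 : k < 112
  · exact WeilFormatC.diagShift_row_of_check tSh104 k (by omega) (by omega)
  by_cases hs112 : k < 120
  · exact WeilFormatC.diagShift_row_of_check tSh112 k (by omega) (by omega)
  by_cases hs120 : k < 128
  · exact WeilFormatC.diagShift_row_of_check tSh120 k (by omega) (by omega)
  by_cases hs128 : k < 136
  · exact WeilFormatC.diagShift_row_of_check tSh128 k (by omega) (by omega)
  by_cases hs136 : k < 144
  · exact WeilFormatC.diagShift_row_of_check tSh136 k (by omega) (by omega)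
  by_cases hs144 : k < 152
  · exact WeilFormatC.diagShift_row_of_check tSh144 k (by omega) (by omega)
  by_cases hs152 : k < 160
  · exact WeilFormatC.diagShift_row_of_check tSh152 k (by omega) (by omega)
  by_cases hs160 : k < 168
  · exact WeilFormatC.diagShift_row_of_check tSh160 k (by omega) (by omega)
  by_cases hs168 : k < 176
  · exact WeilFormatC.diagShift_row_of_check tSh168 k (by omega) (by omega)
  by_cases hs176 : k < 184
  · exact WeilFormatC.diagShift_row_of_check tSh176 k (by omega) (by omega)
  by_cases hs184 : k < 192
  · exact WeilFormatC.diagShift_row_of_check tSh184 k (by omega) (by omega)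
  by_cases hs192 : k < 200
  · exact WeilFormatC.diagShift_row_of_check tSh192 k (by omega) (by omega)
  by_cases hs200 : k < 208
  · exact WeilFormatC.diagShift_row_of_check tSh200 k (by omega) (by omega)
  by_cases hs208 : k < 216
  · exact WeilFormatC.diagShift_row_of_check tSh208 k (by omega) (by omega)
  by_cases hs216 : k < 224
  · exact WeilFormatC.diagShift_row_of_check tSh216 k (by omega) (by omega)
  by_cases hs224 : k < 232
  · exact WeilFormatC.diagShift_row_of_check tSh224 k (by omega) (by omega)
  by_cases hs232 : k < 240
  · exact WeilFormatC.diagShift_row_of_check tSh232 k (by omega) (by omega)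
  by_cases hs240 : k < 248
  · exact WeilFormatC.diagShift_row_of_check tSh240 k (by omega) (by omega)
  exact WeilFormatC.diagShift_row_of_check tSh248 k (by omega) (by omega)

end Summit.RiemannHypothesis.RiemannHypothesis.Theorems.WeilFormatCData.O1035CBOdd
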